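import Summits.AtomisticToContinuum.Crystallization.Theses.FluxTubeKepler

/-!
# `FluxCellKepler` (stmt-AtomisticToContinuum-15221), line `Sketch` — DOM is satisfiable by an explicit local credit

The crux `FluxTubeKepler.FluxCellKepler` asks (among other things) for a LOCAL tail credit `τ`, a
real function of the pattern `pattern_i = {x_j − x_i : dist (x_j, x_i) ≤ R₁}` of relative positions
around a site, with the domination property

* (DOM) `Σ_i site₆(x)_i ≤ Σ_i τ(pattern_i)` for EVERY finite injective configuration `x` of `ℝ³`
  (no minimal separation assumed), `site₆(x)_i = Σ_{k ≠ i} dist(x_i, x_k)⁻⁶`.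

This file certifies that DOM alone is satisfiable at `R₁ = 4` by the explicit local credit
`τ(S) = Σ_{v ∈ S} ‖v‖⁻⁶ + K · #S` for a suitable constant `K` (registered stub
`stub_domSatisfiable` of the line's skeleton).

## Proof

Split `site₆(i)` into the near part (`dist ≤ 4`), which is exactly `Σ_{v ∈ pattern_i} ‖v‖⁻⁶`
(the map `j ↦ x_j − x_i` is injective and the term `v = 0` vanishes since `0⁻¹ = 0`), and the far
part (`dist > 4`). For the far part index the unit cubes containing the points by
`m(k) = (⌊x_k⌋₀, ⌊x_k⌋₁, ⌊x_k⌋₂) ∈ ℤ³`; a far pair `(i, k)` has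
`dist(x_i, x_k) ≥ (1 + |m(i)_l − m(k)_l|) / 2` in every coordinate `l`, hence
`dist⁻⁶ ≤ 64 Π_l (1 + |m(i)_l − m(k)_l|)⁻²`. With `c_k` the number of points in the cube of `x_k`
(all of which lie in `pattern_k`, cube-mates being within `√3 ≤ 4`), the weighted AM–GM inequality
`w_{ik} ≤ ½ w_{ik} (c_i / c_k + c_k / c_i)` and the symmetry of the weight give
`Σ_{i,k} w_{ik} ≤ Σ_i c_i Σ_k w_{ik} / c_k = Σ_i c_i Σ_{b occupied} W(m(i), b) ≤ 64 G³ Σ_i c_i`, where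
`G = Σ_{t ∈ ℤ} (1 + |t|)⁻²` bounds every one-dimensional factor (the sum over occupied cubes is
dominated by the sum over the product of the coordinate projections). Hence `K = 64 G³` works.
Everything is a finite sum except the harmless constant `G`.
-/

namespace Summit.AtomisticToContinuum.Crystallization.Theorems.FluxCellKeplerSketchDom

open scoped BigOperators
open Literature.MathematicalPhysics.StatisticalMechanics

/-! ## One-dimensional weight `(1 + |t|)⁻²` -/

/-- The weight `t ↦ (1 + |t|)⁻²` is summable over `ℤ`. [folklore] -/
private theorem summable_weight : Summable (fun t : ℤ => 1 / (1 + |(t : ℝ)|) ^ 2) := by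
  have h1 : Summable (fun n : ℕ => 1 / (1 + (n : ℝ)) ^ 2) := by
    have h := (summable_nat_add_iff 1).mpr (Real.summable_one_div_nat_pow.mpr one_lt_two)
    refine h.congr fun n => ?_
    push_cast
    ring
  refine Summable.of_nat_of_neg ?_ ?_
  · simpa using h1
  · simpa using h1

/-- Any finite sum of translates of the weight is bounded by the full series
`G = Σ_{t ∈ ℤ} (1 + |t|)⁻²`. [folklore] -/
private theorem sum_weight_le (T : Finset ℤ) (s : ℤ) :
    ∑ t ∈ T, 1 / (1 + |((s - t : ℤ) : ℝ)|) ^ 2 ≤ ∑' t : ℤ, 1 / (1 + |(t : ℝ)|) ^ 2 := by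
  have hinj : Set.InjOn (fun t => s - t) (T : Set ℤ) := fun a _ b _ h => sub_right_injective h
  rw [← Finset.sum_image hinj (f := fun u : ℤ => 1 / (1 + |(u : ℝ)|) ^ 2)]
  exact summable_weight.sum_le_tsum _ fun _ _ => by positivity

/-- Product trick: for a nonnegative one-dimensional weight `g` whose finite translated sums are
bounded by `G`, the sum of `Π_l g(a_l − b_l)` over any finite set of lattice points `b ∈ ℤ³` is at
most `G³` (dominate by the sum over the product of the coordinate projections). [folklore] -/
private theorem sum_prod_le_cube (g : ℤ → ℝ) (G : ℝ) (hg : ∀ t, 0 ≤ g t)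
    (hG : ∀ (T : Finset ℤ) (s : ℤ), ∑ t ∈ T, g (s - t) ≤ G)
    (B : Finset (Fin 3 → ℤ)) (a : Fin 3 → ℤ) :
    ∑ b ∈ B, ∏ l, g (a l - b l) ≤ G ^ 3 := by
  calc ∑ b ∈ B, ∏ l, g (a l - b l)
      ≤ ∑ b ∈ Fintype.piFinset (fun l : Fin 3 => B.image fun b => b l), ∏ l, g (a l - b l) := by
        refine Finset.sum_le_sum_of_subset_of_nonneg (fun b hb => ?_) fun b _ _ => ?_
        · exact Fintype.mem_piFinset.2 fun l => Finset.mem_image_of_mem _ hb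
        · exact Finset.prod_nonneg fun l _ => hg _
    _ = ∏ l, ∑ t ∈ B.image (fun b => b l), g (a l - t) :=
        (Finset.prod_univ_sum (fun l : Fin 3 => B.image fun b => b l) (fun l t => g (a l - t))).symm
    _ ≤ ∏ _l : Fin 3, G :=
        Finset.prod_le_prod (fun l _ => Finset.sum_nonneg fun t _ => hg _) fun l _ => hG _ _
    _ = G ^ 3 := by rw [Finset.prod_const, Finset.card_univ, Fintype.card_fin]

/-! ## Unit cubes -/

/-- Two points of `ℝ³` in the same half-open unit cube `Π_l [m_l, m_l + 1)` are within distance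
`√3 ≤ 4`. [folklore] -/
private theorem dist_le_of_floor_eq (u v : EuclideanSpace ℝ (Fin 3))
    (h : ∀ l : Fin 3, ⌊u l⌋ = ⌊v l⌋) : dist u v ≤ 4 := by
  have hl : ∀ l : Fin 3, dist (u l) (v l) ^ 2 ≤ 1 := by
    intro l
    have hu1 := Int.floor_le (u l)
    have hu2 := Int.lt_floor_add_one (u l)
    have hv1 := Int.floor_le (v l)
    have hv2 := Int.lt_floor_add_one (v l)
    rw [h l] at hu1 hu2
    rw [Real.dist_eq]
    have h1 : |u l - v l| ≤ 1 := abs_sub_le_iff.2 ⟨by linarith, by linarith⟩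
    have h0 : 0 ≤ |u l - v l| := abs_nonneg _
    nlinarith
  have hsq : dist u v ^ 2 ≤ 3 := by
    rw [EuclideanSpace.dist_sq_eq]
    calc ∑ l, dist (u l) (v l) ^ 2 ≤ ∑ _l : Fin 3, (1 : ℝ) := Finset.sum_le_sum fun l _ => hl l
      _ = 3 := by simp
  nlinarith [dist_nonneg (x := u) (y := v)]

/-- Far pairs: if `dist (v, u) > 4` then `dist(u, v)⁻⁶ ≤ 64 Π_l (1 + |⌊u_l⌋ − ⌊v_l⌋|)⁻²`, since
`dist ≥ max (4, |⌊u_l⌋ − ⌊v_l⌋| − 1) ≥ (1 + |⌊u_l⌋ − ⌊v_l⌋|) / 2` coordinatewise. [folklore] -/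
private theorem inv_dist_pow_le (g : ℤ → ℝ) (hg : ∀ t, g t = 1 / (1 + |(t : ℝ)|) ^ 2)
    (u v : EuclideanSpace ℝ (Fin 3)) (a b : Fin 3 → ℤ) (ha : ∀ l, a l = ⌊u l⌋)
    (hb : ∀ l, b l = ⌊v l⌋) (h : 4 < dist v u) :
    ((dist u v)⁻¹) ^ 6 ≤ 64 * ∏ l, g (a l - b l) := by
  have hd : 4 < dist u v := by rwa [dist_comm]
  have hd0 : 0 < dist u v := by linarith
  have hcoord : ∀ l : Fin 3, 1 + |((a l - b l : ℤ) : ℝ)| ≤ 2 * dist u v := by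
    intro l
    have h1 : dist (u l) (v l) ≤ dist u v := PiLp.dist_apply_le u v l
    rw [Real.dist_eq] at h1
    have hu1 := Int.floor_le (u l)
    have hu2 := Int.lt_floor_add_one (u l)
    have hv1 := Int.floor_le (v l)
    have hv2 := Int.lt_floor_add_one (v l)
    rw [ha, hb, Int.cast_sub]
    have h2 : |((⌊u l⌋ : ℤ) : ℝ) - ((⌊v l⌋ : ℤ) : ℝ)| ≤ |u l - v l| + 1 :=
      abs_sub_le_iff.2 ⟨by linarith [le_abs_self (u l - v l)], by linarith [neg_abs_le (u l - v l)]⟩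
    linarith
  have hpos : ∀ l : Fin 3, 0 < 1 + |((a l - b l : ℤ) : ℝ)| := fun l => by positivity
  have hfac : ∀ l : Fin 3, 1 / (2 * dist u v) ^ 2 ≤ g (a l - b l) := fun l => by
    rw [hg]
    exact one_div_le_one_div_of_le (pow_pos (hpos l) 2) (pow_le_pow_left₀ (hpos l).le (hcoord l) 2)
  calc ((dist u v)⁻¹) ^ 6 = 64 * ∏ _l : Fin 3, 1 / (2 * dist u v) ^ 2 := by
        rw [Finset.prod_const, Finset.card_univ, Fintype.card_fin]
        field_simp
        ring
    _ ≤ 64 * ∏ l, g (a l - b l) := by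
        gcongr with l _
        exact hfac l

/-! ## Bookkeeping: near part, far part, weighted AM–GM, fibres -/

/-- The site energy for `V(r) = r⁻⁶` splits into the near (`dist ≤ 4`, the site itself included,
its term being `0⁻⁶ = 0`) and the far (`dist > 4`) parts. [folklore] -/
private theorem siteEnergy_eq_near_add_far {N : ℕ} (x : Fin N → EuclideanSpace ℝ (Fin 3))
    (i : Fin N) :
    siteEnergy (fun r => (r⁻¹) ^ 6) x i
      = ∑ k ∈ Finset.univ.filter (fun j : Fin N => dist (x j) (x i) ≤ 4),
          ((dist (x i) (x k))⁻¹) ^ 6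
        + ∑ k ∈ Finset.univ.filter (fun j : Fin N => ¬ dist (x j) (x i) ≤ 4),
          ((dist (x i) (x k))⁻¹) ^ 6 := by
  unfold siteEnergy
  rw [Finset.sum_erase _ (by simp), Finset.sum_filter_add_sum_filter_not]

/-- The near part is exactly the pattern credit `Σ_{v ∈ pattern_i} ‖v‖⁻⁶`: `j ↦ x_j − x_i` is
injective on an injective configuration. [folklore] -/
private theorem sum_pattern_eq {N : ℕ} (x : Fin N → EuclideanSpace ℝ (Fin 3))
    (hx : Function.Injective x) (i : Fin N) :
    ∑ v ∈ (Finset.univ.filter fun j : Fin N => dist (x j) (x i) ≤ 4).image (fun j => x j - x i),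
        (‖v‖⁻¹) ^ 6
      = ∑ k ∈ Finset.univ.filter (fun j : Fin N => dist (x j) (x i) ≤ 4),
          ((dist (x i) (x k))⁻¹) ^ 6 := by
  rw [Finset.sum_image fun _ _ _ _ h => hx (sub_left_injective h)]
  exact Finset.sum_congr rfl fun k _ => by rw [dist_comm, dist_eq_norm]

/-- The pattern has as many elements as there are sites within distance `4`. [folklore] -/
private theorem card_pattern_eq {N : ℕ} (x : Fin N → EuclideanSpace ℝ (Fin 3))
    (hx : Function.Injective x) (i : Fin N) :
    ((Finset.univ.filter fun j : Fin N => dist (x j) (x i) ≤ 4).image fun j => x j - x i).card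
      = (Finset.univ.filter fun j : Fin N => dist (x j) (x i) ≤ 4).card :=
  Finset.card_image_of_injOn fun _ _ _ _ h => hx (sub_left_injective h)

/-- The far part of site `i` is dominated by the cube weights `w_{ik} = 64 Π_l g(m(i)_l − m(k)_l)`
summed over ALL sites `k`. [folklore] -/
private theorem far_le {N : ℕ} (x : Fin N → EuclideanSpace ℝ (Fin 3)) (g : ℤ → ℝ)
    (hg : ∀ t, g t = 1 / (1 + |(t : ℝ)|) ^ 2) (m : Fin N → Fin 3 → ℤ)
    (hm : ∀ k l, m k l = ⌊x k l⌋) (i : Fin N) :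
    ∑ k ∈ Finset.univ.filter (fun j : Fin N => ¬ dist (x j) (x i) ≤ 4), ((dist (x i) (x k))⁻¹) ^ 6
      ≤ ∑ k, 64 * ∏ l, g (m i l - m k l) := by
  calc ∑ k ∈ Finset.univ.filter (fun j : Fin N => ¬ dist (x j) (x i) ≤ 4),
          ((dist (x i) (x k))⁻¹) ^ 6
      ≤ ∑ k ∈ Finset.univ.filter (fun j : Fin N => ¬ dist (x j) (x i) ≤ 4),
          64 * ∏ l, g (m i l - m k l) :=
        Finset.sum_le_sum fun k hk =>
          inv_dist_pow_le g hg (x i) (x k) (m i) (m k) (hm i) (hm k)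
            (not_le.1 (Finset.mem_filter.1 hk).2)
    _ ≤ ∑ k, 64 * ∏ l, g (m i l - m k l) :=
        Finset.sum_le_sum_of_subset_of_nonneg (Finset.filter_subset _ _) fun k _ _ =>
          mul_nonneg (by norm_num) (Finset.prod_nonneg fun l _ => by rw [hg]; positivity)

/-- Weighted AM–GM for a symmetric nonnegative kernel: `Σ_{i,k} w_{ik} ≤ Σ_i c_i Σ_k w_{ik} / c_k`
for positive weights `c`, from `2 ≤ c_i / c_k + c_k / c_i` and the symmetry `i ↔ k`. [folklore] -/
private theorem sum_sum_le_weighted {N : ℕ} (w : Fin N → Fin N → ℝ) (c : Fin N → ℝ)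
    (hw : ∀ i k, w i k = w k i) (hw0 : ∀ i k, 0 ≤ w i k) (hc : ∀ i, 0 < c i) :
    ∑ i, ∑ k, w i k ≤ ∑ i, c i * ∑ k, w i k / c k := by
  have hswap : ∑ i, ∑ k, w i k * (c k / c i) = ∑ i, ∑ k, w i k * (c i / c k) := by
    rw [Finset.sum_comm]
    exact Finset.sum_congr rfl fun i _ => Finset.sum_congr rfl fun k _ => by rw [hw]
  have hpt : ∀ i k, 2 * w i k ≤ w i k * (c i / c k) + w i k * (c k / c i) := by
    intro i k
    have h2 : 2 ≤ c i / c k + c k / c i := by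
      rw [div_add_div _ _ (hc k).ne' (hc i).ne', le_div_iff₀ (mul_pos (hc k) (hc i))]
      nlinarith [sq_nonneg (c i - c k)]
    rw [← mul_add]
    nlinarith [hw0 i k]
  calc ∑ i, ∑ k, w i k = (1 / 2) * ∑ i, ∑ k, 2 * w i k := by
        rw [Finset.mul_sum]
        refine Finset.sum_congr rfl fun i _ => ?_
        rw [Finset.mul_sum]
        exact Finset.sum_congr rfl fun k _ => by ring
    _ ≤ (1 / 2) * ∑ i, ∑ k, (w i k * (c i / c k) + w i k * (c k / c i)) := by
        gcongr with i _ k _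
        exact hpt i k
    _ = ∑ i, ∑ k, w i k * (c i / c k) := by
        simp only [Finset.sum_add_distrib]
        rw [hswap]
        ring
    _ = ∑ i, c i * ∑ k, w i k / c k := by
        refine Finset.sum_congr rfl fun i _ => ?_
        rw [Finset.mul_sum]
        exact Finset.sum_congr rfl fun k _ => by ring

/-- Fibre count: dividing a function of the cube by the occupancy of the cube and summing over the
sites gives the sum over the OCCUPIED cubes. [folklore] -/
private theorem sum_div_card_fiber {N : ℕ} {β : Type*} [DecidableEq β] (m : Fin N → β)
    (W : β → ℝ) :
    ∑ k, W (m k) / ((Finset.univ.filter fun j => m j = m k).card : ℝ)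
      = ∑ b ∈ Finset.univ.image m, W b := by
  rw [← Finset.sum_fiberwise_of_maps_to (s := Finset.univ) (t := Finset.univ.image m) (g := m)
    fun k _ => Finset.mem_image_of_mem m (Finset.mem_univ k)]
  refine Finset.sum_congr rfl fun b hb => ?_
  have hpos : (0 : ℝ) < ((Finset.univ.filter fun j => m j = b).card : ℝ) := by
    obtain ⟨k, -, rfl⟩ := Finset.mem_image.1 hb
    exact_mod_cast Finset.card_pos.2 ⟨k, by simp⟩
  have heq : ∀ k ∈ Finset.univ.filter (fun k => m k = b),
      W (m k) / ((Finset.univ.filter fun j => m j = m k).card : ℝ)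
        = W b / ((Finset.univ.filter fun j => m j = b).card : ℝ) := by
    intro k hk
    rw [(Finset.mem_filter.1 hk).2]
  rw [Finset.sum_congr rfl heq, Finset.sum_const, nsmul_eq_mul]
  field_simp

/-! ## The registered stub -/

/-- **DOM is satisfiable by an explicit local credit** (stub `stub_domSatisfiable` of the crux item
`stmt-AtomisticToContinuum-15221`, line `Sketch`): there is a constant `K` such that for every finite
injective configuration `x` of `ℝ³`
`Σ_i site₆(x)_i ≤ Σ_i (Σ_{v ∈ pattern_i} ‖v‖⁻⁶ + K · #pattern_i)`, where
`pattern_i = {x_j − x_i : dist(x_j, x_i) ≤ 4}` (a finset of relative positions containing `0`, whose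
term vanishes as `0⁻¹ = 0`). Proof: near/far split at distance `4`, unit-cube bookkeeping and the
weighted AM–GM inequality, with `K = 64 (Σ_{t ∈ ℤ} (1 + |t|)⁻²)³`. [folklore] -/
theorem stub_domSatisfiable : ∃ K : ℝ, ∀ (N : ℕ) (x : Fin N → EuclideanSpace ℝ (Fin 3)), Function.Injective x → ∑ i, siteEnergy (fun r => (r⁻¹) ^ 6) x i ≤ ∑ i, (∑ v ∈ (Finset.univ.filter fun j : Fin N => dist (x j) (x i) ≤ 4).image (fun j => x j - x i), (‖v‖⁻¹) ^ 6 + K * (((Finset.univ.filter fun j : Fin N => dist (x j) (x i) ≤ 4).image fun j => x j - x i).card : ℝ)) := by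
  obtain ⟨g, hg⟩ : ∃ g : ℤ → ℝ, ∀ t, g t = 1 / (1 + |(t : ℝ)|) ^ 2 := ⟨_, fun t => rfl⟩
  obtain ⟨G, hG⟩ : ∃ G : ℝ, G = ∑' t : ℤ, 1 / (1 + |(t : ℝ)|) ^ 2 := ⟨_, rfl⟩
  have hg0 : ∀ t, 0 ≤ g t := fun t => by rw [hg]; positivity
  have hG0 : 0 ≤ G := by rw [hG]; exact tsum_nonneg fun t => by positivity
  have hGsum : ∀ (T : Finset ℤ) (s : ℤ), ∑ t ∈ T, g (s - t) ≤ G := by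
    intro T s
    rw [hG]
    simp only [hg]
    exact sum_weight_le T s
  refine ⟨64 * G ^ 3, fun N x hx => ?_⟩
  obtain ⟨m, hm⟩ : ∃ m : Fin N → Fin 3 → ℤ, ∀ k l, m k l = ⌊x k l⌋ := ⟨_, fun k l => rfl⟩
  -- occupancy of the cube of site `i`
  obtain ⟨c, hc⟩ : ∃ c : Fin N → ℝ, ∀ i, c i = ((Finset.univ.filter fun j => m j = m i).card : ℝ) :=
    ⟨_, fun i => rfl⟩
  have hc_pos : ∀ i, 0 < c i := fun i => by
    rw [hc]
    exact_mod_cast Finset.card_pos.2 ⟨i, by simp⟩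
  have hc_le : ∀ i, c i ≤ ((Finset.univ.filter fun j : Fin N => dist (x j) (x i) ≤ 4).card : ℝ) := by
    intro i
    rw [hc]
    exact_mod_cast Finset.card_le_card fun j hj => by
      simp only [Finset.mem_filter, Finset.mem_univ, true_and] at hj ⊢
      exact dist_le_of_floor_eq (x j) (x i) fun l => by rw [← hm, ← hm, hj]
  -- the cube weights
  have hw_symm : ∀ i k, (64 * ∏ l, g (m i l - m k l)) = 64 * ∏ l, g (m k l - m i l) := by
    intro i k
    congr 1
    exact Finset.prod_congr rfl fun l _ => by rw [hg, hg, Int.cast_sub, Int.cast_sub, abs_sub_comm]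
  have hw0 : ∀ i k, 0 ≤ 64 * ∏ l, g (m i l - m k l) := fun i k =>
    mul_nonneg (by norm_num) (Finset.prod_nonneg fun l _ => hg0 _)
  -- far part, summed
  have hfar : ∑ i, ∑ k ∈ Finset.univ.filter (fun j : Fin N => ¬ dist (x j) (x i) ≤ 4),
      ((dist (x i) (x k))⁻¹) ^ 6
        ≤ 64 * G ^ 3
          * ∑ i, ((Finset.univ.filter fun j : Fin N => dist (x j) (x i) ≤ 4).card : ℝ) := by
    calc ∑ i, ∑ k ∈ Finset.univ.filter (fun j : Fin N => ¬ dist (x j) (x i) ≤ 4),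
            ((dist (x i) (x k))⁻¹) ^ 6
        ≤ ∑ i, ∑ k, 64 * ∏ l, g (m i l - m k l) :=
          Finset.sum_le_sum fun i _ => far_le x g hg m hm i
      _ ≤ ∑ i, c i * ∑ k, (64 * ∏ l, g (m i l - m k l)) / c k :=
          sum_sum_le_weighted (fun i k => 64 * ∏ l, g (m i l - m k l)) c hw_symm hw0 hc_pos
      _ = ∑ i, c i * ∑ b ∈ Finset.univ.image m, 64 * ∏ l, g (m i l - b l) := by
          refine Finset.sum_congr rfl fun i _ => ?_
          rw [← sum_div_card_fiber m (fun b => 64 * ∏ l, g (m i l - b l))]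
          simp only [hc]
      _ ≤ ∑ i, c i * (64 * G ^ 3) := by
          refine Finset.sum_le_sum fun i _ => mul_le_mul_of_nonneg_left ?_ (hc_pos i).le
          rw [← Finset.mul_sum]
          exact mul_le_mul_of_nonneg_left (sum_prod_le_cube g G hg0 hGsum _ _) (by norm_num)
      _ ≤ ∑ i, ((Finset.univ.filter fun j : Fin N => dist (x j) (x i) ≤ 4).card : ℝ)
            * (64 * G ^ 3) :=
          Finset.sum_le_sum fun i _ => mul_le_mul_of_nonneg_right (hc_le i) (by positivity)
      _ = 64 * G ^ 3
            * ∑ i, ((Finset.univ.filter fun j : Fin N => dist (x j) (x i) ≤ 4).card : ℝ) := by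
          rw [Finset.mul_sum]
          exact Finset.sum_congr rfl fun i _ => by ring
  -- assemble
  calc ∑ i, siteEnergy (fun r => (r⁻¹) ^ 6) x i
      = ∑ i, ∑ k ∈ Finset.univ.filter (fun j : Fin N => dist (x j) (x i) ≤ 4),
            ((dist (x i) (x k))⁻¹) ^ 6
        + ∑ i, ∑ k ∈ Finset.univ.filter (fun j : Fin N => ¬ dist (x j) (x i) ≤ 4),
            ((dist (x i) (x k))⁻¹) ^ 6 := by
        rw [← Finset.sum_add_distrib]
        exact Finset.sum_congr rfl fun i _ => siteEnergy_eq_near_add_far x i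
    _ ≤ ∑ i, ∑ k ∈ Finset.univ.filter (fun j : Fin N => dist (x j) (x i) ≤ 4),
            ((dist (x i) (x k))⁻¹) ^ 6
        + 64 * G ^ 3
          * ∑ i, ((Finset.univ.filter fun j : Fin N => dist (x j) (x i) ≤ 4).card : ℝ) :=
        add_le_add le_rfl hfar
    _ = ∑ i, (∑ v ∈ (Finset.univ.filter fun j : Fin N => dist (x j) (x i) ≤ 4).image
            (fun j => x j - x i), (‖v‖⁻¹) ^ 6
          + 64 * G ^ 3 * (((Finset.univ.filter fun j : Fin N => dist (x j) (x i) ≤ 4).image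
            fun j => x j - x i).card : ℝ)) := by
        rw [Finset.sum_add_distrib, Finset.mul_sum]
        congr 1
        · exact Finset.sum_congr rfl fun i _ => (sum_pattern_eq x hx i).symm
        · exact Finset.sum_congr rfl fun i _ => by rw [card_pattern_eq x hx i]

end Summit.AtomisticToContinuum.Crystallization.Theorems.FluxCellKeplerSketchDom
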